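import Literature.AlgebraicGeometry.HodgeTheory.QbarFamilyLocalSystem
import Literature.AlgebraicGeometry.HodgeTheory.RationalLatticeIntegral
import Literature.AlgebraicGeometry.HodgeTheory.IntegralClassesCountable
import Literature.AlgebraicGeometry.HodgeTheory.HodgeStructureOfHodgeModel
import Literature.AlgebraicTopology.SingularHomology.CohomologyRingChangeFunctoriality
import Literature.AlgebraicGeometry.Motives.HodgeClassesBoundedNormFinite
import HarnessLib

/-!
# Finiteness of monodromy orbits from a positive rational form and the integral lattice (CDK, Deligne)

Family `hodge`, layer `Literature/AlgebraicGeometry/HodgeTheory` (fact seat of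
`bku_finite_monodromyOrbit_of_isHodgeGenericIn`). The printed proof of "at a Hodge-generic point
every Hodge class has finite monodromy orbit" (Baldi–Klingler–Ullmo §3.2 with Klingler–Otwinowska–
Urbanik §1.1.1; Deligne, Hodge II 4.2; Cattani–Deligne–Kaplan 1995 §1) has a Hodge-theoretic half —
at a Hodge-generic point `s` the monodromy translates `γ_* α` of a Hodge class `α` are again Hodge
classes, and the polarization `Q` is flat, so they all have the norm `Q(α, α)` — and a lattice half:
rational `(p,p)` classes with a common denominator and bounded `Q`-norm are FINITE in number, `Q`
being positive definite on them (Hodge–Riemann). This file PROVES the lattice half on the tree's real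
carriers (`complexBetti`, `IsRationalClass`, `IsIntegralClass`, `transportFun`), with the
Hodge-theoretic half as explicit hypotheses (no definitions, no named facts):

* `finite_setOf_isIntegralClass_norm_le` — for `X` smooth projective, a property `P` of classes in
  `Hᵏ(X(ℂ); ℂ)` stable under `0`, sums and rational multiples, and a `ℂ`-bilinear `Q` rational on
  rational classes and positive on the non-zero rational classes with `P`: **the integral classes `x`
  with `P x` and `Q(x,x) ≤ K` are finite in number** — rational classes are the finite-dimensional
  `ℚ`-space `Hᵏ(X(ℂ); ℚ)` (`ofRatClass`, injective; `finite_singularCohomology_rat_complexPoints`),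
  the integral ones come from the finitely generated `Hᵏ(X(ℂ); ℤ)`
  (`Motives.bettiCohomologyInt_finite_holds`, `isIntegralClass_iff_mem_range_ringChange`), and a
  finitely generated subgroup meets a bounded region of a positive-definite rational quadratic space
  in a finite set (`Motives.finite_mem_of_posDef_of_fg`, Sylvester over `ℚ`);
  `finite_setOf_nsmul_isIntegralClass_norm_le` — the same with a fixed denominator `N`;
* `finite_setOf_isContinuationAlong_of_norm_eq` — for a smooth projective family over a
  quasi-projective base smooth of pure dimension `d`: **if all monodromy translates of a rational
  class `α ∈ Hᵏ(X_s(ℂ); ℂ)` have property `P` and `Q`-norm `Q(α, α)`, the monodromy orbit of `α` (its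
  flat continuations along loops) is finite** — the translates are rational with a common
  denominator (`IsRationalClass.exists_nsmul_isIntegralClass`: `N α` is integral; the integral
  structure is flat, `isIntegralClass_transportFun_of_isSmoothProjectiveFamily`);
  `finite_setOf_isContinuationAlong_of_norm_eq_baseChangeHom` — the same in the hypotheses shape of
  the named fact (complexification of a family over a smooth irreducible quasi-projective `S₀` over
  a field, `QbarFamilyLocalSystem`).

So the named fact (equivalently its real-carrier form, `HodgeGenericRealCarrier`) is reduced to:
a polarization `Q` on `H²ᵖ(X_s(ℂ); ℂ)` rational on rational classes and positive on rational
`(p,p)` classes (Hodge–Riemann, Voisin I Thm. 6.32 — the tree's `hardLefschetz_hodgeRiemann` is the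
sign-free shadow), and the two orbit statements at a Hodge-generic point (Deligne's "theorem of the
fixed part"/André 1992 §5, or Cattani–Deligne–Kaplan) — none of which is in the tree.

## References

* [CattaniDeligneKaplan1995JAMS] E. Cattani, P. Deligne, A. Kaplan, On the locus of Hodge classes,
  J. Amer. Math. Soc. 8 (1995), §1 (Thm. 1.1, Cor. 1.2 and the lattice argument).
* [DeligneHodgeII1971] P. Deligne, Théorie de Hodge II, Publ. Math. IHÉS 40 (1971), 4.2.
* [BaldiKlinglerUllmo2024] G. Baldi, B. Klingler, E. Ullmo, Invent. Math. 235 (2024), §3.2.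
* [VoisinHodgeI2002] C. Voisin, Hodge Theory and Complex Algebraic Geometry I, CUP 2002, §7.1.1,
  Thm. 6.32, §9.2.1.
* [HatcherAT2002] A. Hatcher, Algebraic Topology, CUP 2002, §3.1 p. 198, App. A Cor. A.9.
* [Liu2002] Q. Liu, Algebraic Geometry and Arithmetic Curves, OUP 2002, Prop. 3.1.23.
-/

noncomputable section

open CategoryTheory AlgebraicGeometry
open _root_.Topology
open Literature.AlgebraicTopology.SingularHomology

namespace Literature.AlgebraicGeometry.HodgeTheory

section HodgeTheory

/-! ### The lattice argument on one smooth projective variety -/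

section OneVariety

variable {n : ℕ} {X : Motives.SchemeOver ℂ} {k : ℕ}

/-- **Integral classes of bounded norm and given type are finite in number** (the lattice argument
of Cattani–Deligne–Kaplan 1995, §1 / Deligne, on the tree's real carriers). Let `X` be smooth
projective, `P` a property of classes in `Hᵏ(X(ℂ); ℂ)` stable under `0`, sums and rational
multiples (e.g. "of Hodge type `(p,p)`"), and `Q` a `ℂ`-bilinear form on `Hᵏ(X(ℂ); ℂ)` taking
RATIONAL values on rational classes and POSITIVE values `Q(x,x) > 0` on the non-zero rational classes
with `P`. Then for every bound `K` there are only finitely many INTEGRAL classes `x` with `P x` and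
`Q(x,x) ≤ K`. Proof: rational classes are `Hᵏ(X(ℂ); ℚ)` (`ofRatClass`, injective), a
finite-dimensional `ℚ`-space (`finite_singularCohomology_rat_complexPoints`); the classes with `P`
form a subspace on which `Q` is a positive-definite `ℚ`-quadratic form; the integral classes in it
form a finitely generated `ℤ`-submodule (they come from the finitely generated `Hᵏ(X(ℂ); ℤ)`,
`Motives.bettiCohomologyInt_finite_holds`, `isIntegralClass_iff_mem_range_ringChange`); and a
finitely generated subgroup meets a bounded region of a positive-definite rational quadratic space in
a finite set (`Motives.finite_mem_of_posDef_of_fg`: Sylvester over `ℚ` and bounded denominators).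
[cite: CattaniDeligneKaplan1995JAMS, §1] -/
theorem finite_setOf_isIntegralClass_norm_le (hX : Motives.IsSmoothProjective n X)
    (P : singularCohomology ℂ ℂ (Motives.ComplexPoints X) k → Prop) (hP0 : P 0)
    (hPadd : ∀ x y, P x → P y → P (x + y)) (hPsmul : ∀ (c : ℚ) x, P x → P ((c : ℂ) • x))
    (Q : singularCohomology ℂ ℂ (Motives.ComplexPoints X) k →ₗ[ℂ]
      singularCohomology ℂ ℂ (Motives.ComplexPoints X) k →ₗ[ℂ] ℂ)
    (hQrat : ∀ x y, IsRationalClass x → IsRationalClass y → ∃ q : ℚ, Q x y = q)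
    (hQpos : ∀ x, IsRationalClass x → P x → x ≠ 0 → ∃ r : ℚ, 0 < r ∧ Q x x = r) (K : ℚ) :
    {x : singularCohomology ℂ ℂ (Motives.ComplexPoints X) k |
      IsIntegralClass x ∧ P x ∧ ∃ q : ℚ, Q x x = q ∧ q ≤ K}.Finite := by
  classical
  -- the rational lattice `ι : Hᵏ(X(ℂ); ℚ) ↪ Hᵏ(X(ℂ); ℂ)`
  set Y := Motives.ComplexPoints X
  set V := singularCohomology ℚ ℚ Y k
  haveI : FiniteDimensional ℚ V := finite_singularCohomology_rat_complexPoints hX k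
  set ι : V →+ singularCohomology ℂ ℂ Y k := ofRatClass Y k
  have hιrat : ∀ a : V, IsRationalClass (ι a) := isRationalClass_ofRatClass
  have hιinj : Function.Injective ι := ofRatClass_injective k
  have hιsmul : ∀ (c : ℚ) (a : V), ι (c • a) = (c : ℂ) • ι a := Motives.ofRatClass_smul Y k
  -- the rational form `Bq` on `V` underlying `Q`
  have hBq : ∀ a b : V, ∃ q : ℚ, Q (ι a) (ι b) = q := fun a b ↦ hQrat _ _ (hιrat a) (hιrat b)
  choose Bq hBq using hBq
  have hcast : Function.Injective ((↑) : ℚ → ℂ) := Rat.cast_injective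
  let B : V →ₗ[ℚ] V →ₗ[ℚ] ℚ := LinearMap.mk₂ ℚ Bq
    (fun a a' b ↦ hcast (by
      rw [Rat.cast_add, ← hBq, ← hBq, ← hBq, map_add, map_add, LinearMap.add_apply]))
    (fun c a b ↦ hcast (by
      rw [smul_eq_mul, Rat.cast_mul, ← hBq, ← hBq, hιsmul, map_smul, LinearMap.smul_apply,
        smul_eq_mul]))
    (fun a b b' ↦ hcast (by rw [Rat.cast_add, ← hBq, ← hBq, ← hBq, map_add, map_add]))
    (fun c a b ↦ hcast (by
      rw [smul_eq_mul, Rat.cast_mul, ← hBq, ← hBq, hιsmul, map_smul, smul_eq_mul]))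
  have hB : ∀ a b : V, ((B a b : ℚ) : ℂ) = Q (ι a) (ι b) := fun a b ↦ (hBq a b).symm
  -- the subspace of classes with `P`
  let VP : Submodule ℚ V :=
    { carrier := {a | P (ι a)}
      zero_mem' := by change P (ι 0); rw [map_zero]; exact hP0
      add_mem' := fun {a b} ha hb ↦ by change P (ι (a + b)); rw [map_add]; exact hPadd _ _ ha hb
      smul_mem' := fun c a ha ↦ by change P (ι (c • a)); rw [hιsmul]; exact hPsmul c _ ha }
  -- the positive-definite quadratic form on it
  let q : QuadraticForm ℚ VP := (LinearMap.BilinMap.toQuadraticMap B).comp VP.subtype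
  have hq : ∀ v : VP, ((q v : ℚ) : ℂ) = Q (ι v) (ι v) := fun v ↦ hB v v
  have hqpos : ∀ v : VP, v ≠ 0 → 0 < q v := by
    intro v hv
    have hv' : ι v ≠ 0 := fun h ↦ hv (Subtype.ext (hιinj (h.trans (map_zero ι).symm)))
    obtain ⟨r, hr, hrq⟩ := hQpos (ι v) (hιrat v) v.2 hv'
    have : q v = r := hcast ((hq v).trans hrq)
    rwa [this]
  -- the integral lattice in `VP` is finitely generated
  let LP : Submodule ℤ VP :=
    { carrier := {v | IsIntegralClass (ι v)}
      zero_mem' := by change IsIntegralClass (ι ((0 : VP) : V)); rw [Submodule.coe_zero, map_zero]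
                      exact IsIntegralClass.zero
      add_mem' := fun {a b} ha hb ↦ by
        change IsIntegralClass (ι ((a + b : VP) : V))
        rw [Submodule.coe_add, map_add]; exact ha.add hb
      smul_mem' := fun c a ha ↦ by
        change IsIntegralClass (ι ((c • a : VP) : V))
        rw [Submodule.coe_smul_of_tower, map_zsmul]
        simpa only [Int.cast_smul_eq_zsmul] using ha.zsmul c }
  have hLP : LP.FG := by
    -- `LP` embeds `ℤ`-linearly into the image `LV` of the finitely generated `Hᵏ(X(ℂ); ℤ)` in `V`
    let M : Type := singularCohomology ℤ ℤ Y k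
    have hM : @Module.Finite ℤ M _ _ (AddCommGroup.toIntModule M) := by
      convert Motives.bettiCohomologyInt_finite_holds hX k
      exact Subsingleton.elim _ _
    haveI hMfg : AddGroup.FG M := Module.Finite.iff_addGroup_fg.1 hM
    let φ : M →+ V := singularCohomology.ringChange (Int.castRingHom ℚ) Y k
    have hrange : φ.range.FG := (AddGroup.fg_iff_addSubgroup_fg _).1 inferInstance
    let LV : Submodule ℤ V := AddSubgroup.toIntSubmodule φ.range
    have hLV : LV.FG := (Submodule.fg_iff_addSubgroup_fg LV).2 (by simpa [LV] using hrange)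
    haveI : Module.Finite ℤ LV := Module.Finite.iff_fg.2 hLV
    have hφ : ∀ v : VP, IsIntegralClass (ι v) → (v : V) ∈ LV := by
      intro v hv
      obtain ⟨z, hz⟩ := (isIntegralClass_iff_mem_range_ringChange _).1 hv
      refine ⟨z, hιinj ?_⟩
      rw [← hz]
      change ofRatClass Y k (φ z) = _
      rw [ofRatClass_eq_ringChange, ← ringChange_comp_apply,
        RingHom.ext_int ((algebraMap ℚ ℂ).comp (Int.castRingHom ℚ)) (Int.castRingHom ℂ)]
    let ψ : LP →ₗ[ℤ] LV :=
      { toFun := fun v ↦ ⟨((v : VP) : V), hφ v v.2⟩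
        map_add' := fun a b ↦ rfl
        map_smul' := fun c a ↦ rfl }
    have hψ : Function.Injective ψ := by
      intro a b h
      have h' : (((a : VP) : V)) = ((b : VP) : V) := congrArg (fun w : LV ↦ (w : V)) h
      exact Subtype.ext (Subtype.ext h')
    haveI : Module.Finite ℤ LP := Module.Finite.of_injective ψ hψ
    exact Module.Finite.iff_fg.1 inferInstance
  -- the finite set in `VP` and its image
  have hfin := Motives.finite_mem_of_posDef_of_fg q hqpos LP hLP K
  refine (hfin.image fun v : VP ↦ ι v).subset ?_
  rintro x ⟨hxint, hxP, r, hr, hrK⟩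
  obtain ⟨a, rfl⟩ := (isRationalClass_iff_mem_range_ofRatClass x).1 hxint.isRationalClass
  refine ⟨⟨a, hxP⟩, ⟨?_, ?_⟩, rfl⟩
  · exact hxint
  · have : q ⟨a, hxP⟩ = r := hcast ((hq ⟨a, hxP⟩).trans hr)
    rwa [this]

/-- The same with a fixed denominator: classes `x` with `P x`, `Q(x,x) ≤ K` and `N x` INTEGRAL
(`N ≥ 1`) are finite in number (scale by `N`). [cite: CattaniDeligneKaplan1995JAMS, §1] -/
theorem finite_setOf_nsmul_isIntegralClass_norm_le (hX : Motives.IsSmoothProjective n X)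
    (P : singularCohomology ℂ ℂ (Motives.ComplexPoints X) k → Prop) (hP0 : P 0)
    (hPadd : ∀ x y, P x → P y → P (x + y)) (hPsmul : ∀ (c : ℚ) x, P x → P ((c : ℂ) • x))
    (Q : singularCohomology ℂ ℂ (Motives.ComplexPoints X) k →ₗ[ℂ]
      singularCohomology ℂ ℂ (Motives.ComplexPoints X) k →ₗ[ℂ] ℂ)
    (hQrat : ∀ x y, IsRationalClass x → IsRationalClass y → ∃ q : ℚ, Q x y = q)
    (hQpos : ∀ x, IsRationalClass x → P x → x ≠ 0 → ∃ r : ℚ, 0 < r ∧ Q x x = r) (K : ℚ)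
    {N : ℕ} (hN : 0 < N) :
    {x : singularCohomology ℂ ℂ (Motives.ComplexPoints X) k |
      IsIntegralClass ((N : ℂ) • x) ∧ P x ∧ ∃ q : ℚ, Q x x = q ∧ q ≤ K}.Finite := by
  have hfin := finite_setOf_isIntegralClass_norm_le hX P hP0 hPadd hPsmul Q hQrat hQpos
    ((N : ℚ) ^ 2 * K)
  have hinj : Function.Injective fun x : singularCohomology ℂ ℂ (Motives.ComplexPoints X) k ↦
      (N : ℂ) • x :=
    smul_right_injective _ (by exact_mod_cast hN.ne')
  refine (hfin.preimage hinj.injOn).subset ?_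
  rintro x ⟨hxint, hxP, r, hr, hrK⟩
  refine ⟨hxint, ?_, (N : ℚ) ^ 2 * r, ?_, ?_⟩
  · simpa using hPsmul (N : ℚ) x hxP
  · simp only [map_smul, LinearMap.smul_apply, smul_eq_mul, hr]
    push_cast
    ring
  · exact mul_le_mul_of_nonneg_left hrK (sq_nonneg _)

end OneVariety

/-! ### Finite monodromy orbits -/

section Orbit

variable {𝒳 S : Motives.SchemeOver ℂ} (f : 𝒳 ⟶ S) (k : ℕ)

/-- Continuation along a path is transport (private copy of
`isContinuationAlong_iff_transportFun_eq` of `HodgeGenericQbarDescentProofs`, kept here so that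
this file does not import that concurrently rewritten file). [cite: VoisinHodgeI2002, §9.2.1] -/
private theorem isContinuationAlong_iff_transportFun_eq''
    (hU : IsCohomologicallyLocallyTrivialOn f (Set.univ : Set (Motives.ComplexPoints S)))
    {s t : Motives.ComplexPoints S} (γ : Path s t) (α : complexBetti (Motives.fiberOver f s) k)
    (β : complexBetti (Motives.fiberOver f t) k) :
    IsContinuationAlong γ α β ↔
      transportFun f k hU (s := ⟨s, Set.mem_univ s⟩) (t := ⟨t, Set.mem_univ t⟩)
        ⟦γ.map (continuous_id.subtype_mk fun x ↦ Set.mem_univ x)⟧ α = β := by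
  constructor
  · rintro ⟨Γ, hΓ⟩
    exact transportFun_eq_of_path f k hU _ Γ fun u ↦ hΓ u
  · rintro rfl
    obtain ⟨Γ, hΓ⟩ := exists_path_transportFun f k hU (s := ⟨s, Set.mem_univ s⟩)
      (t := ⟨t, Set.mem_univ t⟩) (γ.map (continuous_id.subtype_mk fun x ↦ Set.mem_univ x)) α
    exact ⟨Γ, fun u ↦ hΓ u⟩

/-- The set of continuations along loops is the range of transport over `π₁` (private copy of
`setOf_isContinuationAlong_eq_range_transportFun`, same reason). [cite: VoisinHodgeI2002, §9.2.1] -/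
private theorem setOf_isContinuationAlong_eq_range_transportFun''
    (hU : IsCohomologicallyLocallyTrivialOn f (Set.univ : Set (Motives.ComplexPoints S)))
    (s : Motives.ComplexPoints S) (α : complexBetti (Motives.fiberOver f s) k) :
    {β : complexBetti (Motives.fiberOver f s) k | ∃ γ : Path s s, IsContinuationAlong γ α β} =
      Set.range fun γ : Path.Homotopic.Quotient
          (⟨s, Set.mem_univ s⟩ : (Set.univ : Set (Motives.ComplexPoints S))) ⟨s, Set.mem_univ s⟩ ↦
        transportFun f k hU γ α := by
  ext β
  constructor
  · rintro ⟨γ, hγ⟩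
    exact ⟨_, (isContinuationAlong_iff_transportFun_eq'' f k hU γ α β).1 hγ⟩
  · rintro ⟨γ, rfl⟩
    induction γ using Quotient.ind with
    | _ γ =>
      obtain ⟨Γ, hΓ⟩ := exists_path_transportFun f k hU γ α
      exact ⟨γ.map continuous_subtype_val, Γ, fun u ↦ hΓ u⟩

/-- **Finite monodromy orbit from a positive rational form: the lattice half of "at a Hodge-generic
point every Hodge class has finite monodromy orbit"** (Cattani–Deligne–Kaplan 1995 §1; Deligne,
Hodge II 4.2; Baldi–Klingler–Ullmo §3.2), on the tree's real carriers. Let `f : 𝒳 ⟶ S` be a smooth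
projective family over a quasi-projective base smooth of pure dimension `d` over `ℂ` (so that
`Rᵏ f_* ℂ` is a local system on `S(ℂ)`), `s ∈ S(ℂ)`, `P` a property of classes of `Hᵏ(X_s(ℂ); ℂ)`
stable under `0`, sums and rational multiples ("of type `(p,p)`"), and `Q` a `ℂ`-bilinear form on
`Hᵏ(X_s(ℂ); ℂ)`, rational on rational classes and positive on non-zero rational classes with `P`
(a polarization; Hodge–Riemann). If ALL monodromy translates `γ_* α` of a rational class `α` have
property `P` and the same `Q`-norm as `α` — the two consequences of Hodge-genericity of `s` in the
printed proof (the translates of a Hodge class at a Hodge-generic point are Hodge classes, and the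
polarization is flat) — then the monodromy orbit of `α` (the set of its flat continuations along
loops at `s`) is FINITE: the translates are rational with a common denominator `N` (`N α`
integral, `IsRationalClass.exists_nsmul_isIntegralClass`; the integral structure is flat,
`isIntegralClass_transportFun_of_isSmoothProjectiveFamily`), of type `P` and of norm `Q(α, α)`, and
such classes are finite in number (`finite_setOf_nsmul_isIntegralClass_norm_le`).
[cite: CattaniDeligneKaplan1995JAMS, §1] [cite: BaldiKlinglerUllmo2024, §3.2] -/
theorem finite_setOf_isContinuationAlong_of_norm_eq {n : ℕ} (d : ℕ)
    (hf : Motives.IsSmoothProjectiveFamily f n) (hS : IsQuasiProjectiveOver S)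
    [SmoothOfRelativeDimension d S.hom] (s : Motives.ComplexPoints S)
    (P : complexBetti (Motives.fiberOver f s) k → Prop) (hP0 : P 0)
    (hPadd : ∀ x y, P x → P y → P (x + y)) (hPsmul : ∀ (c : ℚ) x, P x → P ((c : ℂ) • x))
    (Q : complexBetti (Motives.fiberOver f s) k →ₗ[ℂ] complexBetti (Motives.fiberOver f s) k →ₗ[ℂ] ℂ)
    (hQrat : ∀ x y, IsRationalClass x → IsRationalClass y → ∃ q : ℚ, Q x y = q)
    (hQpos : ∀ x, IsRationalClass x → P x → x ≠ 0 → ∃ r : ℚ, 0 < r ∧ Q x x = r)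
    (α : complexBetti (Motives.fiberOver f s) k) (hα : IsRationalClass α)
    (hPorb : ∀ γ : Path.Homotopic.Quotient
        (⟨s, Set.mem_univ s⟩ : (Set.univ : Set (Motives.ComplexPoints S))) ⟨s, Set.mem_univ s⟩,
      P (transportFun f k (isCohomologicallyLocallyTrivialOn_univ_of_isSmoothProjectiveFamily f d hf hS)
        γ α :))
    (hQorb : ∀ γ : Path.Homotopic.Quotient
        (⟨s, Set.mem_univ s⟩ : (Set.univ : Set (Motives.ComplexPoints S))) ⟨s, Set.mem_univ s⟩,
      Q (transportFun f k (isCohomologicallyLocallyTrivialOn_univ_of_isSmoothProjectiveFamily f d hf hS)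
          γ α :)
        (transportFun f k (isCohomologicallyLocallyTrivialOn_univ_of_isSmoothProjectiveFamily f d hf hS)
          γ α :) = Q α α) :
    {β : complexBetti (Motives.fiberOver f s) k | ∃ γ : Path s s, IsContinuationAlong γ α β}.Finite := by
  have hX : Motives.IsSmoothProjective n (Motives.fiberOver f s) := hf.isSmoothProjective s
  obtain ⟨N, hN, hNα⟩ := hα.exists_nsmul_isIntegralClass hX
  obtain ⟨q₀, hq₀⟩ := hQrat α α hα hα
  have hfin := finite_setOf_nsmul_isIntegralClass_norm_le hX P hP0 hPadd hPsmul Q hQrat hQpos q₀ hN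
  rw [setOf_isContinuationAlong_eq_range_transportFun'' f k
    (isCohomologicallyLocallyTrivialOn_univ_of_isSmoothProjectiveFamily f d hf hS) s α]
  refine hfin.subset ?_
  rintro _ ⟨γ, rfl⟩
  refine ⟨?_, hPorb γ, q₀, (hQorb γ).trans hq₀, le_rfl⟩
  rw [← transportFun_smul]
  exact isIntegralClass_transportFun_of_isSmoothProjectiveFamily f k d hf hS γ hNα

/-- Quasi-projectivity is stable under extension of the base field (private copy of
`IsQuasiProjectiveOver.baseChangeHom` of `HodgeGenericQbarDescentProofs`, same reason as above).
[cite: Liu2002, Prop. 3.1.23 and Rem. 3.1.20] -/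
private theorem isQuasiProjectiveOver_baseChangeHom'' {F L : Type} [Field F] [Field L] (σ : F →+* L)
    {T : Motives.SchemeOver F} (h : IsQuasiProjectiveOver T) :
    IsQuasiProjectiveOver ((Motives.baseChangeHom σ).obj T) := by
  obtain ⟨P, j, hP, hj⟩ := h
  letI := σ.toAlgebra
  refine ⟨(Motives.baseChangeHom σ).obj P, (Motives.baseChangeHom σ).map j, hP.baseChange_obj L, ?_⟩
  exact MorphismProperty.IsStableUnderBaseChange.of_isPullback
    (Motives.isPullback_baseChange_map_left L j).flip hj

/-- **The same for the complexification `f = f₀ ⊗_σ ℂ` of a family over a smooth irreducible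
quasi-projective base `S₀` over a field `F` (e.g. `ℚ̄`)** — the hypotheses shape of the named fact
`bku_finite_monodromyOrbit_of_isHodgeGenericIn` (its Hodge-theoretic content being exactly the two
orbit hypotheses `hPorb`, `hQorb` for `P` = "of type `(p,p)`" and `Q` a polarization).
[cite: CattaniDeligneKaplan1995JAMS, §1] [cite: BaldiKlinglerUllmo2024, §3.2] -/
theorem finite_setOf_isContinuationAlong_of_norm_eq_baseChangeHom {F : Type} [Field F] (σ : F →+* ℂ)
    {𝒳₀ S₀ : Motives.SchemeOver F} (f₀ : 𝒳₀ ⟶ S₀) {n : ℕ}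
    (hf : Motives.IsSmoothProjectiveFamily ((Motives.baseChangeHom σ).map f₀) n)
    (hS₀ : IsQuasiProjectiveOver S₀) [IrreducibleSpace S₀.left] [Smooth S₀.hom]
    (s : Motives.ComplexPoints ((Motives.baseChangeHom σ).obj S₀))
    (P : complexBetti (Motives.fiberOver ((Motives.baseChangeHom σ).map f₀) s) k → Prop) (hP0 : P 0)
    (hPadd : ∀ x y, P x → P y → P (x + y)) (hPsmul : ∀ (c : ℚ) x, P x → P ((c : ℂ) • x))
    (Q : complexBetti (Motives.fiberOver ((Motives.baseChangeHom σ).map f₀) s) k →ₗ[ℂ]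
      complexBetti (Motives.fiberOver ((Motives.baseChangeHom σ).map f₀) s) k →ₗ[ℂ] ℂ)
    (hQrat : ∀ x y, IsRationalClass x → IsRationalClass y → ∃ q : ℚ, Q x y = q)
    (hQpos : ∀ x, IsRationalClass x → P x → x ≠ 0 → ∃ r : ℚ, 0 < r ∧ Q x x = r)
    (α : complexBetti (Motives.fiberOver ((Motives.baseChangeHom σ).map f₀) s) k)
    (hα : IsRationalClass α)
    (hPorb : ∀ γ : Path.Homotopic.Quotient
        (⟨s, Set.mem_univ s⟩ : (Set.univ : Set (Motives.ComplexPoints ((Motives.baseChangeHom σ).obj S₀))))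
        ⟨s, Set.mem_univ s⟩,
      P (transportFun ((Motives.baseChangeHom σ).map f₀) k
        (isCohomologicallyLocallyTrivialOn_univ_baseChangeHom σ f₀ hf hS₀) γ α :))
    (hQorb : ∀ γ : Path.Homotopic.Quotient
        (⟨s, Set.mem_univ s⟩ : (Set.univ : Set (Motives.ComplexPoints ((Motives.baseChangeHom σ).obj S₀))))
        ⟨s, Set.mem_univ s⟩,
      Q (transportFun ((Motives.baseChangeHom σ).map f₀) k
          (isCohomologicallyLocallyTrivialOn_univ_baseChangeHom σ f₀ hf hS₀) γ α :)
        (transportFun ((Motives.baseChangeHom σ).map f₀) k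
          (isCohomologicallyLocallyTrivialOn_univ_baseChangeHom σ f₀ hf hS₀) γ α :) = Q α α) :
    {β : complexBetti (Motives.fiberOver ((Motives.baseChangeHom σ).map f₀) s) k |
        ∃ γ : Path s s, IsContinuationAlong γ α β}.Finite := by
  obtain ⟨d, hd⟩ := exists_smoothOfRelativeDimension_baseChangeHom σ S₀
  haveI := hd
  exact finite_setOf_isContinuationAlong_of_norm_eq _ k d hf (isQuasiProjectiveOver_baseChangeHom'' σ hS₀)
    s P hP0 hPadd hPsmul Q hQrat hQpos α hα hPorb hQorb

end Orbit

end HodgeTheory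

end Literature.AlgebraicGeometry.HodgeTheory

end
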